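import Summits.CriticalPhenomena.PercolationContinuityZ3.Theorems.PercNearOneGluingNoHeavyLowerTailMajorityGluingZFourteenEightP73
import Summits.CriticalPhenomena.PercolationContinuityZ3.Theorems.PercNearOneGluingNoHeavyLowerTailMajorityGluingZFourteenEightHG7C1
import Summits.CriticalPhenomena.PercolationContinuityZ3.Theorems.PercNearOneGluingNoHeavyLowerTailMajorityGluingZFourteenEightHG7C2
import Summits.CriticalPhenomena.PercolationContinuityZ3.Theorems.PercNearOneGluingNoHeavyLowerTailMajorityGluingZFourteenEightHG7C3
import Summits.CriticalPhenomena.PercolationContinuityZ3.Theorems.PercNearOneGluingNoHeavyLowerTailMajorityGluingZFourteenEightHG7C4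
import Summits.CriticalPhenomena.PercolationContinuityZ3.Theorems.PercNearOneGluingNoHeavyLowerTailMajorityGluingZFourteenEightHG7C5
import Summits.CriticalPhenomena.PercolationContinuityZ3.Theorems.PercNearOneGluingNoHeavyLowerTailMajorityGluingZFourteenEightHG7C6
import Summits.CriticalPhenomena.PercolationContinuityZ3.Theorems.PercNearOneGluingNoHeavyLowerTailMajorityGluingZRangeAM
import HarnessLib

/-!
# Group 7 of 7 of the `(14,8)` certificate at `c = 3/2`: its aggregate-merge tree IS the concatenation of its 6 key-range chunks (lane prim-rate, constants-miner 1, gen 39; cert/mkhier.py)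

Support file for the closed crux `NoHeavyLowerTail` (stmt-CriticalPhenomena-4575), majority-gluing line.  The 1 parts P73 (kit j310356) carry verified
type-space digests `…D`; `fourteenEightT2G7T` is their binary tree of aggregated merges (`am`, …MajorityGluingZRangeAM, depth 0); the kernel verifies `fourteenEightT2G7T = [chunks].flatten`
(`fourteenEightT2G7_eq`), and `fourteenEightT2G7_val` identifies the value of the group's digests with the value of its chunks (`evalC_am`).  No sorries. [cite: VandenbergKahn2001, Thm 1.2 (p. 123)]
-/

namespace Summit.CriticalPhenomena.PercolationContinuityZ3.Theorems

namespace HubOnly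
namespace QCert

/-- The aggregate-merge tree of group 7. -/
def fourteenEightT2G7T : List (ℕ × ℤ) :=
  fourteenEightTP73D

set_option maxRecDepth 8192 in
set_option maxHeartbeats 0 in
/-- **The tree of group 7 equals the concatenation of its key-range chunks** (kernel evaluation). -/
theorem fourteenEightT2G7_eq : fourteenEightT2G7T = [fourteenEightT2G7C1, fourteenEightT2G7C2, fourteenEightT2G7C3, fourteenEightT2G7C4, fourteenEightT2G7C5, fourteenEightT2G7C6].flatten := by
  decide +kernel

/-- The tree's value is the value of the group's digests. -/
theorem fourteenEightT2G7_treeVal (val : ℕ → ℝ) : evalC val fourteenEightT2G7T = evalC val [fourteenEightTP73D].flatten := by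
  simp only [fourteenEightT2G7T, List.flatten_cons, List.flatten_nil, evalC_append, evalC_nil', add_zero]

/-- **The value of group 7's digests is the value of its chunks.** -/
theorem fourteenEightT2G7_val (val : ℕ → ℝ) : evalC val [fourteenEightTP73D].flatten = evalC val [fourteenEightT2G7C1, fourteenEightT2G7C2, fourteenEightT2G7C3, fourteenEightT2G7C4, fourteenEightT2G7C5, fourteenEightT2G7C6].flatten := by
  rw [← fourteenEightT2G7_treeVal val, fourteenEightT2G7_eq]

end QCert
end HubOnly

end Summit.CriticalPhenomena.PercolationContinuityZ3.Theorems
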